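import Summits.BirchSwinnertonDyer.BirchSwinnertonDyer.Theorems.SemiOrdinaryEisensteinDescentWildSplitEisensteinValueAtOneVVisibleOwnPoint412317d1FactFree
import Summits.BirchSwinnertonDyer.Rank1Residual.GaloisImage.ThreeCongruenceHesseCertificateLemmas
import Literature.NumberTheory.EllipticCurves.Fisher2012.HesseFamilyThreeReverseProofs
import HarnessLib

/-!
# Route `SemiOrdinaryEisensteinDescent`, crux #2″ `WildSplitEisensteinValueAtOneV` (E_𝟙^V, stmt-BirchSwinnertonDyer-26610):
# row `412317d1` θ-FREE AND Fisher-free — the last of the nine in-range content rows with binders {CT, GZK} only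
# (cell `pub/bsd-wall`, width seat `bsd-wall-soed-p1-w3` g22; `--supports stmt-BirchSwinnertonDyer-26610`; THEOREMS ONLY)

`VisibleOwnPoint.missingLowerBound_412317d1_thetaFree` (w3 g21, `…VisibleNineThetaFree.lean`, p650646) certifies the `3`-congruence
`θ : F[3] ⥲ E[3]` (`E = 412317d1`, `F = 274878a1`) in the kernel by the direct Hesse pencil `X_E(3)` at `(l : m) = (−108 : 1)`, `u = 12`
(Fisher 2012 Thm. 13.2), but still displays Fisher 2016 Thm. 4.4 (`hF44`) for the place `2`. With the fact-free record of this seat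
(`VisibleOwnPoint412317d1FactFree.missingLowerBound_412317d1_of_visibleSha_ownPoint_factFree`, p653478; kind (iv) at `2` by the tree
theorem `NonsplitKummerUnramified.h1Equiv_mem_selmerLocalKer_of_hasGoodReductionAt_of_nonsplit`, p653117) the row is now stated with
the inputs of the other eight θ-free rows: `hCT`, `hGZK`, Cremona's `r_an(E) = 1` and `ord₃ #Ш(E)_an ≤ 2`. HONEST FRAMING: one curve; BSD₃(E)
NOT claimed; the crux is NOT advanced class-wide; BSD is not proved by any of this.

References: [Fisher2012Hessian] Thm. 13.2; [Fisher2016Visualizing7] Thm. 4.4; [CremonaMazur2000] §3; [Cremona2006].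
-/

set_option autoImplicit false

noncomputable section

open scoped Classical

open WeierstrassCurve Literature.NumberTheory.EllipticCurves
  Literature.NumberTheory.EllipticCurves.Rank1Residual
  Literature.NumberTheory.EllipticCurves.Rank1Residual.Typed
  Literature.NumberTheory.GaloisRepresentations
  Summit.BirchSwinnertonDyer.Rank1Residual.GaloisImage
open NumberField IsDedekindDomain Field

-- the Theorems namespace of this sub repeats the summit name by design (D-0017 nested layout)
set_option linter.dupNamespace false

namespace Summit.BirchSwinnertonDyer.BirchSwinnertonDyer.Theorems.VisibleOwnPoint412317d1FactFree

/-- **Row `412317d1` θ-FREE and FACT-FREE at `2`**: `ord₃ #Ш(E)_an ≤ ord₃ #Ш(E)` for `E = 412317d1` from the partner `F = 274878a1`, the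
congruence `θ : F[3] ⥲ E[3]` CERTIFIED IN THE KERNEL by the direct pencil `X_E(3)` at `(l : m) = (−108 : 1)`, `u = 12` (Fisher 2012 Thm. 13.2,
`VisCerts.torsionIso3_of_hesseCert_mk`, as in `VisibleOwnPoint.missingLowerBound_412317d1_thetaFree`), then
`missingLowerBound_412317d1_of_visibleSha_ownPoint_factFree`. Remaining inputs: `hCT`, `hGZK`; data `hr1`, `hq`/`hv` — EXACTLY those of the
other eight θ-free rows. Per pair; BSD₃(E) NOT claimed. [cite: Fisher2012Hessian, Thm. 13.2 (n = 3) and §8, §13] [cite: Fisher2016Visualizing7, Thm. 4.4 (p. 106)]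
[cite: CremonaMazur2000, §3] [cite: Cremona2006, Table 1 (Cremona labels 412317d1, 274878a1)] -/
theorem missingLowerBound_412317d1_thetaFree_factFree
    (hCT : exists_casselsTate_pairing (K := ℚ)) (hGZK : rank_eq_analyticRank_of_analyticRank_le_one)
    {W F : WeierstrassCurve ℚ} [W.IsElliptic] [W.IsGloballyMinimal] [F.IsElliptic] [F.IsGloballyMinimal]
    (hWeq : W = ⟨0, 0, 1, -240, -1431⟩) (hFeq : F = ⟨1, -1, 0, -36, 1296⟩)
    (hr1 : W.analyticRank = 1) {q : ℚ} (hq : shaAn W = (q : ℂ)) (hv : padicValRat 3 q ≤ 2) :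
    MissingLowerBoundAt W 3 := by
  obtain ⟨θ, hθ⟩ := VisCerts.torsionIso3_of_hesseCert_mk (W := W) (W' := F) hWeq hFeq
    11520 1236168 1737 (-1111941) (by norm_num) (by norm_num) (by norm_num) (by norm_num)
    (-108) 1 12 (by norm_num) (by norm_num) (by norm_num)
  exact missingLowerBound_412317d1_of_visibleSha_ownPoint_factFree hCT hGZK hWeq hFeq hr1 hq hv θ hθ

end Summit.BirchSwinnertonDyer.BirchSwinnertonDyer.Theorems.VisibleOwnPoint412317d1FactFree

end
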